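import Literature.NumberTheory.LFunctions.WeilGroundStateRealZerosProofs
import Literature.NumberTheory.LFunctions.WeilSmallSupportPositivity
import HarnessLib

/-!
# Strict antitonicity of the window bottom — I: the shifted form on finite real combinations
(crux stmt-RiemannHypothesis-1037 `GronwallLeakage`, route WeilWindowFlow; line `Sketch`, lead c6)

Toolkit for the theorem `ε(A) < ε(a)` for `0 < a < A` (`ε = weilGroundEnergy`; file
`WeilWindowFlowGronwallLeakageStrictAnti.lean`). On the window `[-A, A]` the SHIFTED form
`s_A(φ) := Re Q(φ) - ε(A) ∫ |φ|²` is a non-negative real quadratic form on test functions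
(`weilGroundEnergy_mul_le_re`, `shiftedForm_add_le` in the tree). Here:

* `shiftedForm_real_mul` — homogeneity `s_A(r φ) = r² s_A(φ)` for real `r`;
* `isWeilTest_sum_real_mul`, `tsupport_sum_real_mul_subset` — finite real combinations
  `Σ_j c_j F_j` of window test functions are window test functions;
* `sqrt_shiftedForm_sum_le` / `shiftedForm_sum_le_sq` — the seminorm bound
  `√s_A(Σ_j c_j F_j) ≤ Σ_j |c_j| √s_A(F_j)` (subadditivity of `√s_A` iterated over a `Finset`);
* `shiftedForm_translate`, `shiftedForm_sum_translates_le` — for the translates `F_j = g(· + h_j)` of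
  ONE window test function `g` (all with the same value `s_A(F_j) = Re Q(g) - ε(A)‖g‖²`, by
  translation invariance of `Q` and of the `L²` norm): `s_A(Σ_j c_j g(· + h_j)) ≤ (Σ_j |c_j|)² s_A(g)`.

Axioms ⊆ {propext, Classical.choice, Quot.sound}.
-/

-- `Summit.RiemannHypothesis.RiemannHypothesis.…` repeats a namespace component by design (D-0017 layout).
set_option linter.dupNamespace false

noncomputable section

open MeasureTheory Set Filter Complex
open scoped Topology ComplexConjugate BigOperators

namespace Summit.RiemannHypothesis.RiemannHypothesis.Theorems.WeilWindowFlowGronwallLeakage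

open Literature.NumberTheory.LFunctions
open Literature.NumberTheory.LFunctions.ConnesVanSuijlekom

/-! ## Homogeneity -/

/-- `∫ ‖r φ‖² = r² ∫ ‖φ‖²` for a real constant `r` (no hypotheses). [folklore] -/
theorem integral_norm_sq_real_mul (r : ℝ) (φ : ℝ → ℂ) :
    ∫ t, ‖(fun x ↦ (r : ℂ) * φ x) t‖ ^ 2 = r ^ 2 * ∫ t, ‖φ t‖ ^ 2 := by
  simp only [norm_mul, mul_pow, Complex.norm_real, sq_abs, Real.norm_eq_abs]
  exact integral_const_mul _ _

/-- `Re Q(r φ) = r² Re Q(φ)` for a real constant `r` (`weilQuadratic_const_mul`). [folklore] -/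
theorem re_weilQuadratic_real_mul (r : ℝ) (φ : ℝ → ℂ) :
    (weilQuadratic fun x ↦ (r : ℂ) * φ x).re = r ^ 2 * (weilQuadratic φ).re := by
  rw [weilQuadratic_const_mul, Complex.normSq_ofReal, Complex.re_ofReal_mul]
  ring

/-- **Homogeneity of the shifted form**: `s_A(r φ) = r² s_A(φ)`,
`s_A(φ) = Re Q(φ) - ε(A) ∫ |φ|²`, for real `r`. [folklore] -/
theorem shiftedForm_real_mul (A r : ℝ) (φ : ℝ → ℂ) :
    (weilQuadratic fun x ↦ (r : ℂ) * φ x).re -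
        weilGroundEnergy A * ∫ t, ‖(fun x ↦ (r : ℂ) * φ x) t‖ ^ 2 =
      r ^ 2 * ((weilQuadratic φ).re - weilGroundEnergy A * ∫ t, ‖φ t‖ ^ 2) := by
  rw [re_weilQuadratic_real_mul, integral_norm_sq_real_mul]
  ring

/-! ## Finite real combinations of window test functions -/

/-- A finite real combination `t ↦ Σ_{j ∈ s} c_j F_j(t)` of test functions is a test function.
[folklore] -/
theorem isWeilTest_sum_real_mul {ι : Type*} (s : Finset ι) {F : ι → ℝ → ℂ}
    (hF : ∀ j, IsWeilTest (F j)) (c : ι → ℝ) :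
    IsWeilTest fun t ↦ ∑ j ∈ s, (c j : ℂ) * F j t := by
  classical
  induction s using Finset.induction_on with
  | empty =>
    simp only [Finset.sum_empty]
    exact ⟨contDiff_const, HasCompactSupport.zero⟩
  | insert i s hi ih =>
    have h := ((hF i).const_mul (c i)).add ih
    convert h using 1
    funext t
    simp [Finset.sum_insert hi]

/-- The support of a finite real combination of functions supported in `[-A, A]` lies in `[-A, A]`.
[folklore] -/
theorem tsupport_sum_real_mul_subset {ι : Type*} (s : Finset ι) {F : ι → ℝ → ℂ} {A : ℝ}
    (hFs : ∀ j, tsupport (F j) ⊆ Icc (-A) A) (c : ι → ℝ) :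
    tsupport (fun t ↦ ∑ j ∈ s, (c j : ℂ) * F j t) ⊆ Icc (-A) A := by
  refine closure_minimal (fun t ht ↦ ?_) isClosed_Icc
  by_contra hnot
  apply ht
  refine Finset.sum_eq_zero fun j _ ↦ ?_
  have : F j t = 0 := image_eq_zero_of_notMem_tsupport fun h ↦ hnot (hFs j h)
  simp [this]

/-- **Seminorm bound for the shifted form on finite real combinations.** For test functions `F_j`
supported in `[-A, A]` and real coefficients `c_j`:
`√ s_A(Σ_j c_j F_j) ≤ Σ_j |c_j| √ s_A(F_j)`, `s_A(φ) = Re Q(φ) - ε(A) ∫|φ|² ≥ 0` on the window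
(subadditivity `shiftedForm_add_le` iterated, homogeneity `shiftedForm_real_mul`). [folklore] -/
theorem sqrt_shiftedForm_sum_le {ι : Type*} (s : Finset ι) {F : ι → ℝ → ℂ} {A : ℝ}
    (hF : ∀ j, IsWeilTest (F j)) (hFs : ∀ j, tsupport (F j) ⊆ Icc (-A) A) (c : ι → ℝ) :
    Real.sqrt ((weilQuadratic fun t ↦ ∑ j ∈ s, (c j : ℂ) * F j t).re -
        weilGroundEnergy A * ∫ t, ‖∑ j ∈ s, (c j : ℂ) * F j t‖ ^ 2) ≤
      ∑ j ∈ s, |c j| * Real.sqrt ((weilQuadratic (F j)).re -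
        weilGroundEnergy A * ∫ t, ‖F j t‖ ^ 2) := by
  classical
  induction s using Finset.induction_on with
  | empty =>
    simp only [Finset.sum_empty]
    have h0 : (weilQuadratic fun _ : ℝ ↦ (0 : ℂ)).re = 0 := by
      rw [show (fun _ : ℝ ↦ (0 : ℂ)) = 0 from rfl, weilQuadratic_zero, Complex.zero_re]
    simp [h0]
  | insert i s hi ih =>
    -- split off the `i`-th term
    have hsplit : (fun t ↦ ∑ j ∈ insert i s, (c j : ℂ) * F j t) =
        (fun t ↦ (c i : ℂ) * F i t) + fun t ↦ ∑ j ∈ s, (c j : ℂ) * F j t := by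
      funext t
      simp [Finset.sum_insert hi]
    have hsplit' : (fun t ↦ ‖∑ j ∈ insert i s, (c j : ℂ) * F j t‖ ^ 2) =
        fun t ↦ ‖((fun t ↦ (c i : ℂ) * F i t) + fun t ↦ ∑ j ∈ s, (c j : ℂ) * F j t) t‖ ^ 2 := by
      funext t
      simp [Finset.sum_insert hi]
    have h1 : IsWeilTest fun t ↦ (c i : ℂ) * F i t := (hF i).const_mul (c i)
    have h1s : tsupport (fun t ↦ (c i : ℂ) * F i t) ⊆ Icc (-A) A :=
      tsupport_mul_subset_right.trans (hFs i)
    have h2 : IsWeilTest fun t ↦ ∑ j ∈ s, (c j : ℂ) * F j t := isWeilTest_sum_real_mul s hF c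
    have h2s : tsupport (fun t ↦ ∑ j ∈ s, (c j : ℂ) * F j t) ⊆ Icc (-A) A :=
      tsupport_sum_real_mul_subset s hFs c
    have hadd := shiftedForm_add_le h1 h1s h2 h2s
    -- nonnegativity of the pieces
    have hq1 : 0 ≤ (weilQuadratic fun t ↦ (c i : ℂ) * F i t).re -
        weilGroundEnergy A * ∫ t, ‖(fun t ↦ (c i : ℂ) * F i t) t‖ ^ 2 := by
      have := weilGroundEnergy_mul_le_re h1 h1s
      linarith
    have hq2 : 0 ≤ (weilQuadratic fun t ↦ ∑ j ∈ s, (c j : ℂ) * F j t).re -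
        weilGroundEnergy A * ∫ t, ‖∑ j ∈ s, (c j : ℂ) * F j t‖ ^ 2 := by
      have := weilGroundEnergy_mul_le_re h2 h2s
      linarith
    have hqi : 0 ≤ (weilQuadratic (F i)).re - weilGroundEnergy A * ∫ t, ‖F i t‖ ^ 2 := by
      have := weilGroundEnergy_mul_le_re (hF i) (hFs i)
      linarith
    -- homogeneity on the `i`-th term
    have hhom : Real.sqrt ((weilQuadratic fun t ↦ (c i : ℂ) * F i t).re -
        weilGroundEnergy A * ∫ t, ‖(fun t ↦ (c i : ℂ) * F i t) t‖ ^ 2) =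
        |c i| * Real.sqrt ((weilQuadratic (F i)).re - weilGroundEnergy A * ∫ t, ‖F i t‖ ^ 2) := by
      rw [shiftedForm_real_mul, Real.sqrt_mul (sq_nonneg _), Real.sqrt_sq_eq_abs]
    rw [Finset.sum_insert hi, hsplit, hsplit', ← hhom]
    refine (Real.sqrt_le_sqrt hadd).trans ?_
    rw [Real.sqrt_sq (by positivity)]
    gcongr

/-- Squared form of `sqrt_shiftedForm_sum_le`:
`s_A(Σ_j c_j F_j) ≤ (Σ_j |c_j| √ s_A(F_j))²`. [folklore] -/
theorem shiftedForm_sum_le_sq {ι : Type*} (s : Finset ι) {F : ι → ℝ → ℂ} {A : ℝ}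
    (hF : ∀ j, IsWeilTest (F j)) (hFs : ∀ j, tsupport (F j) ⊆ Icc (-A) A) (c : ι → ℝ) :
    (weilQuadratic fun t ↦ ∑ j ∈ s, (c j : ℂ) * F j t).re -
        weilGroundEnergy A * ∫ t, ‖∑ j ∈ s, (c j : ℂ) * F j t‖ ^ 2 ≤
      (∑ j ∈ s, |c j| * Real.sqrt ((weilQuadratic (F j)).re -
        weilGroundEnergy A * ∫ t, ‖F j t‖ ^ 2)) ^ 2 := by
  have h := sqrt_shiftedForm_sum_le s hF hFs c
  have hq : 0 ≤ (weilQuadratic fun t ↦ ∑ j ∈ s, (c j : ℂ) * F j t).re -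
      weilGroundEnergy A * ∫ t, ‖∑ j ∈ s, (c j : ℂ) * F j t‖ ^ 2 := by
    have := weilGroundEnergy_mul_le_re (isWeilTest_sum_real_mul s hF c)
      (tsupport_sum_real_mul_subset s hFs c)
    linarith
  calc _ = (Real.sqrt ((weilQuadratic fun t ↦ ∑ j ∈ s, (c j : ℂ) * F j t).re -
        weilGroundEnergy A * ∫ t, ‖∑ j ∈ s, (c j : ℂ) * F j t‖ ^ 2)) ^ 2 := (Real.sq_sqrt hq).symm
    _ ≤ _ := by gcongr

/-! ## Translates of one window test function -/

/-- **The shifted form is translation invariant**: `s_A(g(· + h)) = s_A(g)`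
(`weilQuadratic_translate`, `integral_norm_sq_translate`). [folklore] -/
theorem shiftedForm_translate (A h : ℝ) (g : ℝ → ℂ) :
    (weilQuadratic fun t ↦ g (t + h)).re - weilGroundEnergy A * ∫ t, ‖g (t + h)‖ ^ 2 =
      (weilQuadratic g).re - weilGroundEnergy A * ∫ t, ‖g t‖ ^ 2 := by
  rw [weilQuadratic_translate, integral_norm_sq_translate]

/-- Translates `g(· + h)` with `0 ≤ h ≤ A - a` of a function supported in `[-a, a]` are supported
in `[-A, A]` (for `a ≤ A`). [folklore] -/
theorem tsupport_translate_subset_window {g : ℝ → ℂ} {a A h : ℝ} (haA : a ≤ A)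
    (hg : tsupport g ⊆ Icc (-a) a) (h0 : 0 ≤ h) (hh : h ≤ A - a) :
    tsupport (fun t ↦ g (t + h)) ⊆ Icc (-A) A := by
  refine (tsupport_translate_subset hg h).trans (Icc_subset_Icc ?_ ?_) <;> linarith

/-- **Almost-invariance bound for spans of translates.** Let `g` be a test function supported in
`[-a, a]`, `a ≤ A`, and `h_j ∈ [0, A - a]` shifts. Then for real `c_j`,
`s_A(Σ_j c_j g(· + h_j)) ≤ (Σ_j |c_j|)² · s_A(g)`: a real combination of translates has shifted
form value controlled by that of `g` alone (seminorm bound + translation invariance). [folklore] -/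
theorem shiftedForm_sum_translates_le {ι : Type*} (s : Finset ι) {g : ℝ → ℂ} {a A : ℝ}
    (hg : IsWeilTest g) (hgs : tsupport g ⊆ Icc (-a) a) (haA : a ≤ A) {h : ι → ℝ}
    (h0 : ∀ j, 0 ≤ h j) (hh : ∀ j, h j ≤ A - a) (c : ι → ℝ) :
    (weilQuadratic fun t ↦ ∑ j ∈ s, (c j : ℂ) * g (t + h j)).re -
        weilGroundEnergy A * ∫ t, ‖∑ j ∈ s, (c j : ℂ) * g (t + h j)‖ ^ 2 ≤
      (∑ j ∈ s, |c j|) ^ 2 * ((weilQuadratic g).re - weilGroundEnergy A * ∫ t, ‖g t‖ ^ 2) := by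
  have hF : ∀ j, IsWeilTest fun t ↦ g (t + h j) := fun j ↦ isWeilTest_translate hg (h j)
  have hFs : ∀ j, tsupport (fun t ↦ g (t + h j)) ⊆ Icc (-A) A := fun j ↦
    tsupport_translate_subset_window haA hgs (h0 j) (hh j)
  have key := shiftedForm_sum_le_sq s hF hFs c
  simp only [shiftedForm_translate] at key
  rw [← Finset.sum_mul, mul_pow] at key
  have hq : 0 ≤ (weilQuadratic g).re - weilGroundEnergy A * ∫ t, ‖g t‖ ^ 2 := by
    have hgA : tsupport g ⊆ Icc (-A) A := hgs.trans (Icc_subset_Icc (by linarith) haA)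
    have := weilGroundEnergy_mul_le_re hg hgA
    linarith
  rwa [Real.sq_sqrt hq] at key

/-- **Headline (registered sub-goal of crux stmt-RiemannHypothesis-1037, line `Sketch`).** For a test
function `g` supported in `[-a, a]`, `a ≤ A`, a step `d ≥ 0` with `m d ≤ A - a`, and real `c`:
`s_A(Σ_{j<m} c_j g(· + j d)) ≤ (m ‖c‖)² s_A(g)` — the span of the `m` equally spaced translates of `g`
inside the window `[-A, A]` has shifted-form values controlled by `s_A(g)` (sup norm on `c`).
[folklore] -/
theorem shiftedForm_span_translates_bound :
    ∀ (m : ℕ) (g : ℝ → ℂ) (a A d : ℝ), IsWeilTest g → tsupport g ⊆ Icc (-a) a → a ≤ A → 0 ≤ d →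
      (m : ℝ) * d ≤ A - a → ∀ c : Fin m → ℝ,
      (weilQuadratic fun t ↦ ∑ j : Fin m, (c j : ℂ) * g (t + (j : ℕ) * d)).re -
          weilGroundEnergy A * ∫ t, ‖∑ j : Fin m, (c j : ℂ) * g (t + (j : ℕ) * d)‖ ^ 2 ≤
        ((m : ℝ) * ‖c‖) ^ 2 * ((weilQuadratic g).re - weilGroundEnergy A * ∫ t, ‖g t‖ ^ 2) := by
  intro m g a A d hg hgs haA hd hmd c
  have hjd : ∀ j : Fin m, ((j : ℕ) : ℝ) * d ≤ A - a := by
    intro j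
    have hj : ((j : ℕ) : ℝ) ≤ m := by exact_mod_cast j.2.le
    exact (mul_le_mul_of_nonneg_right hj hd).trans hmd
  have key := shiftedForm_sum_translates_le (Finset.univ : Finset (Fin m)) hg hgs haA
    (h := fun j : Fin m ↦ ((j : ℕ) : ℝ) * d) (fun j ↦ by positivity) hjd c
  have hq : 0 ≤ (weilQuadratic g).re - weilGroundEnergy A * ∫ t, ‖g t‖ ^ 2 := by
    have hgA : tsupport g ⊆ Icc (-A) A := hgs.trans (Icc_subset_Icc (by linarith) haA)
    have := weilGroundEnergy_mul_le_re hg hgA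
    linarith
  have hsum : ∑ j : Fin m, |c j| ≤ (m : ℝ) * ‖c‖ := by
    calc ∑ j : Fin m, |c j| ≤ ∑ _j : Fin m, ‖c‖ :=
          Finset.sum_le_sum fun j _ ↦ by simpa using norm_le_pi_norm c j
      _ = (m : ℝ) * ‖c‖ := by simp
  have hsum0 : 0 ≤ ∑ j : Fin m, |c j| := Finset.sum_nonneg fun j _ ↦ abs_nonneg _
  exact key.trans (mul_le_mul_of_nonneg_right (pow_le_pow_left₀ hsum0 hsum 2) hq)

end Summit.RiemannHypothesis.RiemannHypothesis.Theorems.WeilWindowFlowGronwallLeakage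

end
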